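import Summits.Ventures.PercRepro.PuncturedLYMChainNeg

/-!
# PercRepro — (SP) BY SUPERPOSITION, PART 11b: THE THROUGH-POINT CERTIFICATE BOUND AND THE NEGATIVE ERROR (p10, gen 31)

With the joint packing count through a point (PuncturedLYMChainNeg): any nonnegative `μ` with
`g(a) ≤ (j − 1 − a)·μ_a + a·μ_{a−1}` (`a + 2 ≤ j`) certifies `Σ_{B' ∋ x, B' ≠ B} g(#(B ∩ B')) ≤ Σ_{a<j−1} μ_a·s'_a`
(`sum_gDef_through_le_of_cert`, `s'_a = C(j,a)·C(n−j−1, j−2−a)`), and the NEGATIVE error at `x` comes only from the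
words through `x`: `errE(x)⁻ ≤ Σ_{B' ∋ x, B' ≠ B} g(#(B ∩ B'))/(n − j)` (`max_neg_errE_le`).
Nothing here asserts (SP) in general.
-/

namespace PercRepro.PuncturedLYM

open Finset

variable {α : Type} [Fintype α] [DecidableEq α]

/-- The through-count `s'_a = C(j, a)·C(n − j − 1, j − 2 − a)` as a rational. -/
def sQ' (α : Type) [Fintype α] (j a : ℕ) : ℚ :=
  ((j.choose a * (Fintype.card α - j - 1).choose (j - 2 - a) : ℕ) : ℚ)

/-- **The through-point certificate bound**: for a code `D`, a word `B ∈ D`, `x ∉ B` and `μ ≥ 0` with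
`g(a) ≤ (j − 1 − a)·μ_a + a·μ_{a−1}` on `a + 2 ≤ j`: `Σ_{B' ∈ D, B' ≠ B, x ∈ B'} g(#(B ∩ B')) ≤ Σ_{a<j−1} μ_a·s'_a`
(`2 ≤ j`). -/
theorem sum_gDef_through_le_of_cert {j : ℕ} {D : Finset (Finset α)} (hD : IsCode j D) (hj : 2 ≤ j)
    {B : Finset α} (hB : B ∈ D) {x : α} (hx : x ∉ B) (mu : ℕ → ℚ)
    (hmu : ∀ a, a + 2 ≤ j → 0 ≤ mu a)
    (hcert : ∀ a, a + 2 ≤ j → gDef α j a ≤ ((j : ℚ) - 1 - a) * mu a + (a : ℚ) * mu (a - 1)) :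
    ∑ B' ∈ (D.erase B).filter (fun B' => x ∈ B'), gDef α j (B ∩ B').card ≤ ∑ a ∈ range (j - 1), mu a * sQ' α j a := by
  have hBc := hD.1 B hB
  -- fibres by the distance `a ≤ j − 2`
  have hmaps : ∀ B' ∈ (D.erase B).filter (fun B' => x ∈ B'), (B ∩ B').card ∈ range (j - 1) := by
    intro B' hB'
    rw [mem_filter] at hB'
    rw [mem_range]
    have hne : B ≠ B' := (ne_of_mem_erase hB'.1).symm
    have := hD.2 B hB B' (mem_of_mem_erase hB'.1) hne
    omega
  rw [← sum_fiberwise_of_maps_to hmaps]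
  -- the fibre at `a` is `throughCount (D.erase B) B x a`
  have hfib : ∀ a ∈ range (j - 1),
      ∑ B' ∈ ((D.erase B).filter (fun B' => x ∈ B')).filter (fun B' => (B ∩ B').card = a), gDef α j (B ∩ B').card =
        (throughCount (D.erase B) B x a : ℚ) * gDef α j a := by
    intro a _
    unfold throughCount
    rw [filter_filter, ← nsmul_eq_mul, ← sum_const]
    apply sum_congr rfl
    intro B' hB'
    rw [(mem_filter.1 hB').2.2]
  rw [sum_congr rfl hfib]
  -- the packing counts in `ℚ`, with the zero classes padded
  set m : ℕ → ℚ := fun a => (throughCount (D.erase B) B x a : ℚ) with hm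
  have hmtop : ∀ a, j - 1 ≤ a → m a = 0 := by
    intro a ha
    rw [hm]
    simp only
    rw [Nat.cast_eq_zero]
    unfold throughCount
    rw [card_eq_zero, filter_eq_empty_iff]
    intro B' hB' h
    have hne : B ≠ B' := (ne_of_mem_erase hB').symm
    have := hD.2 B hB B' (mem_of_mem_erase hB') hne
    omega
  have hpack : ∀ a, ((j : ℚ) - 1 - a) * m a + ((a : ℚ) + 1) * m (a + 1) ≤ sQ' α j a := by
    intro a
    rcases Nat.lt_or_ge (a + 2) j with ha | ha
    · have h := card_through_pair_le (a := a) (isCode_erase hD B) hBc hx ha.le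
      have h2 := card_midSetsAt_le (a := a) hBc hx ha.le
      have h3 : (((throughCount (D.erase B) B x a * (j - 1 - a) + throughCount (D.erase B) B x (a + 1) * (a + 1)) : ℕ) : ℚ)
          ≤ ((j.choose a * (Fintype.card α - j - 1).choose (j - 2 - a) : ℕ) : ℚ) := by exact_mod_cast h.trans h2
      rw [hm]
      simp only
      unfold sQ'
      push_cast [Nat.cast_sub (by omega : a + 1 ≤ j), Nat.cast_sub (by omega : 1 ≤ j)] at h3 ⊢
      have e : ((j - 1 - a : ℕ) : ℚ) = (j : ℚ) - 1 - a := by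
        rw [Nat.cast_sub (by omega), Nat.cast_sub (by omega)]
        push_cast
        ring
      rw [e] at h3
      linarith
    · -- `a ≥ j − 2`: the classes `a` and `a + 1` are at most the top two; `m (a+1) = 0`, and for `a = j − 2` the
      -- packing is the single-class count through `x`
      rcases Nat.eq_or_lt_of_le ha with hae | hlt
      · -- `a = j − 2`: `m (j − 1) = 0`; `(j − 1 − a)·m_a = m_{j−2} ≤ s'_{j−2} = C(j, j−2)·1`
        have hm1 : m (a + 1) = 0 := hmtop (a + 1) (by omega)
        rw [hm1, mul_zero, add_zero]
        have h := card_through_pair_le (a := a) (isCode_erase hD B) hBc hx (by omega)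
        have h2 := card_midSetsAt_le (a := a) hBc hx (by omega)
        have h3 : (((throughCount (D.erase B) B x a * (j - 1 - a) + throughCount (D.erase B) B x (a + 1) * (a + 1)) : ℕ) : ℚ)
            ≤ ((j.choose a * (Fintype.card α - j - 1).choose (j - 2 - a) : ℕ) : ℚ) := by exact_mod_cast h.trans h2
        rw [hm]
        simp only
        unfold sQ'
        have e : ((j - 1 - a : ℕ) : ℚ) = (j : ℚ) - 1 - a := by
          rw [Nat.cast_sub (by omega), Nat.cast_sub (by omega)]
          push_cast
          ring
        push_cast at h3 ⊢
        rw [e] at h3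
        have h4 : (0 : ℚ) ≤ ((a : ℚ) + 1) * (throughCount (D.erase B) B x (a + 1) : ℚ) := by positivity
        linarith
      · have hm0 : m a = 0 := hmtop a (by omega)
        have hm1 : m (a + 1) = 0 := hmtop (a + 1) (by omega)
        rw [hm0, hm1, mul_zero, mul_zero, add_zero]
        unfold sQ'
        positivity
  -- pad the certificate to all `a`: the classes `a ≥ j − 1` have `m a = 0`, so any value works there; use `cert_sum_le`
  -- with `K = j − 1`
  set mu' : ℕ → ℚ := fun a => if a + 2 ≤ j then mu a else 0 with hmu'
  have hmu'0 : ∀ a, 0 ≤ mu' a := by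
    intro a
    rw [hmu']
    simp only
    split_ifs with h
    · exact hmu a h
    · exact le_rfl
  have hmm : ∀ a, 0 ≤ m a := fun a => by rw [hm]; positivity
  -- restrict the sum to `K = j − 1` via `cert_sum_le` applied to `w_a := g(a)` truncated
  set w : ℕ → ℚ := fun a => if a + 2 ≤ j then gDef α j a else 0 with hw
  have hA : ∀ a, (fun a : ℕ => (j : ℚ) - 1 - a) a * m a + (fun a : ℕ => (a : ℚ) + 1) a * m (a + 1) ≤ sQ' α j a :=
    fun a => hpack a
  have hc0 : w 0 ≤ ((j : ℚ) - 1 - (0 : ℕ)) * mu' 0 := by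
    rw [hw, hmu']
    simp only [Nat.cast_zero, sub_zero]
    by_cases h : 0 + 2 ≤ j
    · rw [if_pos h, if_pos h]
      have := hcert 0 h
      simp only [Nat.cast_zero, sub_zero, zero_mul, add_zero] at this
      exact this
    · rw [if_neg h, if_neg h, mul_zero]
  have hcs : ∀ a, w (a + 1) ≤ ((j : ℚ) - 1 - ((a + 1 : ℕ) : ℚ)) * mu' (a + 1) + ((a : ℚ) + 1) * mu' a := by
    intro a
    rw [hw, hmu']
    simp only
    by_cases h : a + 1 + 2 ≤ j
    · rw [if_pos h, if_pos h, if_pos (by omega)]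
      have := hcert (a + 1) h
      rw [Nat.add_sub_cancel] at this
      push_cast at this ⊢
      linarith
    · rw [if_neg h, if_neg h, mul_zero, zero_add]
      by_cases h2 : a + 2 ≤ j
      · rw [if_pos h2]
        exact mul_nonneg (by positivity) (hmu a h2)
      · rw [if_neg h2, mul_zero]
  have key := cert_sum_le m w (sQ' α j) (fun a => (j : ℚ) - 1 - a) (fun a => (a : ℚ) + 1) mu' hmm hmu'0 hA hc0
    hcs (j - 1) (by omega)
  rw [hmtop (j - 1) le_rfl, mul_zero, add_zero] at key
  have hl : ∑ a ∈ range (j - 1), m a * w a = ∑ a ∈ range (j - 1), m a * gDef α j a := by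
    apply sum_congr rfl
    intro a ha
    rw [hw]
    simp only
    rw [if_pos (by have := mem_range.1 ha; omega)]
  have hr : ∑ a ∈ range (j - 1), mu' a * sQ' α j a = ∑ a ∈ range (j - 1), mu a * sQ' α j a := by
    apply sum_congr rfl
    intro a ha
    rw [hmu']
    simp only
    rw [if_pos (by have := mem_range.1 ha; omega)]
  rw [hl, hr] at key
  exact key

/-! ### The negative error through the words through a point -/

/-- **The negative error at `x` comes from the words through `x`**: `errE(x)⁻ ≤ Σ_{B' ∋ x, B' ≠ B} g(#(B ∩ B'))/(n−j)`
(`2j ≤ n`, `j < n`). -/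
theorem max_neg_errE_le {j : ℕ} {D : Finset (Finset α)} (hD : IsCode j D) (hn : 2 * j ≤ Fintype.card α)
    (hjn : j < Fintype.card α) {B : Finset α} (hB : B ∈ D) (x : α) :
    max (- errE α j D B x) 0 ≤
      (∑ B' ∈ (D.erase B).filter (fun B' => x ∈ B'), gDef α j (B ∩ B').card) / ((Fintype.card α : ℚ) - j) := by
  have hnj : (0 : ℚ) < (Fintype.card α : ℚ) - j := by
    have : (j : ℚ) < Fintype.card α := by exact_mod_cast hjn
    linarith
  apply max_le _ (div_nonneg (sum_nonneg (fun B' _ => gDef_nonneg hn)) hnj.le)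
  unfold errE
  rw [neg_le, sum_div]
  -- the terms with `x ∉ B'` are `≥ 0`, the terms with `x ∈ B'` equal `−g/(n−j)`
  have h1 : ∀ B' ∈ (D.erase B).filter (fun B' => x ∈ B'),
      -(gDef α j (B ∩ B').card / ((Fintype.card α : ℚ) - j)) ≤ 1 / ((Fintype.card α : ℚ) - j) - sW α j (dFlux α j) B' B x := by
    intro B' hB'
    rw [mem_filter] at hB'
    unfold sW
    rw [if_pos hB'.2]
    unfold win gDef
    have ha : aOf B' B = (B ∩ B').card := rfl
    rw [ha]
    have e : 1 / ((Fintype.card α : ℚ) - j) - (1 + ((Fintype.card α : ℚ) - 2 * j + (B ∩ B').card) * dFlux α j (B ∩ B').card) /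
        ((Fintype.card α : ℚ) - j) = -((((Fintype.card α : ℚ) - 2 * j + (B ∩ B').card) * dFlux α j (B ∩ B').card) /
        ((Fintype.card α : ℚ) - j)) := by
      field_simp
      ring
    rw [e]
  have h2 : ∀ B' ∈ (D.erase B).filter (fun B' => ¬ x ∈ B'),
      (0 : ℚ) ≤ 1 / ((Fintype.card α : ℚ) - j) - sW α j (dFlux α j) B' B x := by
    intro B' hB'
    rw [mem_filter] at hB'
    unfold sW
    rw [if_neg hB'.2]
    unfold wout
    have hd := dFlux_nonneg (α := α) (j := j) (a := aOf B' B) hjn.le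
    have hcard : aOf B' B ≤ j := by
      unfold aOf
      exact (hD.1 B hB) ▸ card_le_card inter_subset_left
    have hac : (aOf B' B : ℚ) ≤ j := by exact_mod_cast hcard
    have e : 1 / ((Fintype.card α : ℚ) - j) - (1 - ((j : ℚ) - aOf B' B) * dFlux α j (aOf B' B)) / ((Fintype.card α : ℚ) - j) =
        (((j : ℚ) - aOf B' B) * dFlux α j (aOf B' B)) / ((Fintype.card α : ℚ) - j) := by
      field_simp
      ring
    rw [e]
    apply div_nonneg _ hnj.le
    exact mul_nonneg (by linarith) hd
  calc -(∑ B' ∈ (D.erase B).filter (fun B' => x ∈ B'), gDef α j (B ∩ B').card / ((Fintype.card α : ℚ) - j))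
      = ∑ B' ∈ (D.erase B).filter (fun B' => x ∈ B'), -(gDef α j (B ∩ B').card / ((Fintype.card α : ℚ) - j)) := by
        rw [sum_neg_distrib]
    _ ≤ ∑ B' ∈ (D.erase B).filter (fun B' => x ∈ B'), (1 / ((Fintype.card α : ℚ) - j) - sW α j (dFlux α j) B' B x) :=
        sum_le_sum h1
    _ ≤ ∑ B' ∈ (D.erase B).filter (fun B' => x ∈ B'), (1 / ((Fintype.card α : ℚ) - j) - sW α j (dFlux α j) B' B x) +
        ∑ B' ∈ (D.erase B).filter (fun B' => ¬ x ∈ B'), (1 / ((Fintype.card α : ℚ) - j) - sW α j (dFlux α j) B' B x) := by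
        have := sum_nonneg h2
        linarith
    _ = ∑ B' ∈ D.erase B, (1 / ((Fintype.card α : ℚ) - j) - sW α j (dFlux α j) B' B x) :=
        sum_filter_add_sum_filter_not _ _ _

end PercRepro.PuncturedLYM
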